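import Literature.Probability.Percolation.RingSeparation
import Literature.Probability.Percolation.RingFeet
import Literature.Probability.Percolation.ArmEventsInterface
import HarnessLib

/-!
# Two arms from the rim separate the rim sites between their feet from the other rim sites

Topic `Literature/Probability/Percolation`; family `crit-perc`. PROOFS ONLY. The planar separation
fact behind the inner-boundary colour switching for five arms (P. Nolin, *Near-critical percolation
in two dimensions*, EJP 13 (2008), §5.1 Prop. 20 [arXiv 0711.4948: Prop. 19]: "we are allowed to
condition on the black arm … and on the white arm … closest to each other … We can then 'flip'
the remaining region"; after Bollobás–Riordan, *Percolation* (2006), Ch. 7, Claims 7 and 9), in the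
form consumed by `FiveArmInnerExplore.lean`: **two disjoint arms of the annulus `{m ≤ |·| ≤ n}`
started at the rim sites `rp m j_A`, `rp m j_B` (`j_A < j_B < j_A + 6m`) and otherwise of norm
`> m` separate every rim site `rp m j`, `j_A < j < j_B`, from every rim site `rp m j'`,
`j_B < j' < j_A + 6m`: a lattice path between them through sites of norm in `[m, n]` meets one of
the arms** (`rim_separation`). It is the winding-number separation `SepLoop.W_ne` of
`RingSeparation.lean` applied one level up: the arms from their second sites (norm `≥ m + 1`), the
exterior walk on `∂Λ_{n+1}`, and the arc of the ring `∂Λ_m` between the two rim sites; the path,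
followed from its last visit to that arc, steps to a site of norm `m + 1` over a bond of the arc
(`overBond_of_adj_ring`), whose winding number differs from that of the deep hole, while its end is
joined to the hole off the loop.

* `ringPt_adj_idx`, `eq_rp_of_adj_rp` — the ring neighbours of a ring site are its two ring
  neighbours in the enumeration;
* `rim_separation` — **the separation**.

## References

* P. Nolin, Near-critical percolation in two dimensions, *Electron. J. Probab.* 13 (2008), §5.1
  Prop. 20 (arXiv 0711.4948: Prop. 19) [Nolin2008].
* B. Bollobás, O. Riordan, *Percolation*, CUP (2006), Ch. 7 §7.2.3, Claims 7 and 9, pp. 173–175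
  [BollobasRiordan2006].

## Mathlib / tree

Tree: `SepLoop`, `SepLoop.W_ne`, `not_mem_of_ann/ring/deep`, `off_pieces`, `hadj_pieces`
(`RingSeparation.lean`); `rp`, `ringPt_spec`, `exists_eq_rp`, `rp_ne_rp_of_lt`, `rp_add_period`,
`overBond_of_adj_ring`, `triNorm_rp` (`RingArcs.lean`); `pathIn_rp_run` (`RingFeet.lean`);
`latWind_triEmbed_eq_of_pathIn` (`SiteIfaceWinding.lean`); `exists_triGraph_adj_triNorm_eq_add_one`
(`ArmEventsInterface.lean`); `exists_triGraph_adj_triNorm_add_one_eq` (`TriangularLatticeProofs.lean`);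
`PathIn.last_exit`, `PathIn.exists_walk`.
-/

noncomputable section

namespace Literature.Probability.Percolation

open LatticeModels

/-! ### Ring neighbours of a ring site -/

set_option maxHeartbeats 1600000 in
/-- **Adjacent ring sites have consecutive indices** (cyclically). [folklore] -/
theorem ringPt_adj_idx {k i i' : ℕ} (hi : i < 6 * k) (hi' : i' < 6 * k)
    (hadj : triGraph.Adj (ringPt k i) (ringPt k i')) :
    i' = i + 1 ∨ i = i' + 1 ∨ (i = 0 ∧ i' = 6 * k - 1) ∨ (i' = 0 ∧ i = 6 * k - 1) := by
  rw [triGraph_adj_iff_coord] at hadj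
  rcases ringPt_spec k i with h | h | h | h | h | h <;> rcases ringPt_spec k i' with h' | h' | h' | h' | h' | h' <;> omega

/-- **The sites of the ring adjacent to `rp k i` (`i ≥ 1`) are `rp k (i ± 1)`.** [folklore] -/
theorem eq_rp_of_adj_rp {k i : ℕ} (hk : 1 ≤ k) (hi : 1 ≤ i) {b : Site 2} (hb : triNorm b = k)
    (hadj : triGraph.Adj (rp k i) b) : b = rp k (i + 1) ∨ b = rp k (i - 1) := by
  obtain ⟨i', hi', rfl⟩ := exists_eq_rp hk hb
  have hP : 0 < 6 * k := by omega
  have hi₀lt : i % (6 * k) < 6 * k := Nat.mod_lt _ hP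
  have hrp : rp k i = ringPt k (i % (6 * k)) := rfl
  obtain ⟨c, hdm⟩ : ∃ c, c * (6 * k) + i % (6 * k) = i := ⟨i / (6 * k), by rw [mul_comm]; exact Nat.div_add_mod i (6 * k)⟩
  generalize i % (6 * k) = i₀ at hi₀lt hrp hdm
  rw [hrp, rp_of_lt hi'] at hadj
  rcases ringPt_adj_idx hi₀lt hi' hadj with h | h | ⟨h1, h2⟩ | ⟨h1, h2⟩
  · left
    rw [show i + 1 = (i₀ + 1) + c * (6 * k) by omega, rp_add_mul_period, ← h]
  · right
    rw [show i - 1 = (i₀ - 1) + c * (6 * k) by omega, rp_add_mul_period, show i₀ - 1 = i' by omega]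
  · right
    have hc0 : c ≠ 0 := by intro h0; rw [h0, h1] at hdm; omega
    obtain ⟨c', rfl⟩ : ∃ c', c = c' + 1 := ⟨c - 1, by omega⟩
    have hQ : (c' + 1) * (6 * k) = c' * (6 * k) + 6 * k := by ring
    rw [show i - 1 = (6 * k - 1) + c' * (6 * k) by omega, rp_add_mul_period, ← h2]
  · left
    have hQ : (c + 1) * (6 * k) = c * (6 * k) + 6 * k := by ring
    rw [show i + 1 = 0 + (c + 1) * (6 * k) by omega, rp_add_mul_period, ← h1]

/-! ### The separation -/

/-- A walk between distinct sites starts with a bond. [folklore] -/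
theorem Walk.exists_eq_cons {V : Type*} {G : SimpleGraph V} {u v : V} (p : G.Walk u v) (h : u ≠ v) :
    ∃ (w : V) (hw : G.Adj u w) (p' : G.Walk w v), p = SimpleGraph.Walk.cons hw p' := by
  cases p with
  | nil => exact absurd rfl h
  | cons hw p' => exact ⟨_, hw, p', rfl⟩

/-- An exterior walk on `∂Λ_{n+1}` joining neighbours of two sites of `∂Λ_n`. [folklore] -/
theorem exists_exterior_walk {n : ℕ} {yA yB : Site 2} (hyA : triNorm yA = n) (hyB : triNorm yB = n) :
    ∃ (eA eB : Site 2) (E : triGraph.Walk eA eB), triGraph.Adj yA eA ∧ triGraph.Adj eB yB ∧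
      ∀ z ∈ E.support, triNorm z = n + 1 := by
  obtain ⟨eA, hA, hAn⟩ := exists_triGraph_adj_triNorm_eq_add_one yA
  obtain ⟨eB, hB, hBn⟩ := exists_triGraph_adj_triNorm_eq_add_one yB
  rw [hyA] at hAn; rw [hyB] at hBn
  have hk : 1 ≤ n + 1 := by omega
  obtain ⟨a, -, rfl⟩ := exists_eq_rp hk (by exact_mod_cast hAn)
  obtain ⟨b, -, hb⟩ := exists_eq_rp hk (by exact_mod_cast hBn)
  have hrun := pathIn_rp_run hk (S := {z | triNorm z = n + 1}) (a := a) (b := b + 6 * (n + 1) + a * (6 * (n + 1)))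
    (by nlinarith) (fun j _ _ => by show triNorm (rp (n + 1) j) = n + 1; rw [triNorm_rp hk]; push_cast; ring)
  rw [rp_add_mul_period, rp_add_period, ← hb] at hrun
  obtain ⟨E, hE⟩ := hrun.exists_walk
  exact ⟨_, _, E, hA, hB.symm, fun z hz => by exact_mod_cast hE z hz⟩

set_option maxHeartbeats 800000 in
/-- **Rim separation by two arms.** Let `2 ≤ m`, `m + 1 ≤ n`, and let `P_A`, `P_B` be two lattice
paths from the rim sites `rp m j_A`, `rp m j_B` (`j_A < j_B < j_A + 6m`) to sites of norm `n`, all of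
whose other sites have norm in `(m, n]`. Then no lattice path through sites of norm in `[m, n]` off
the two paths joins a rim site `rp m j`, `j_A < j < j_B`, to a rim site `rp m j'`,
`j_B < j' < j_A + 6m` (Bollobás–Riordan's Claim 9 for the loop "arm, exterior arc, arm, inner arc":
the two rim arcs lie on different sides). [cite: BollobasRiordan2006, Ch. 7 proof of Claims 7 and 9 pp. 173–175] -/
theorem rim_separation {m n : ℕ} (hm : 2 ≤ m) (hmn : m + 1 ≤ n) {jA jB : ℕ} (hBA : jB < jA + 6 * m)
    {yA yB : Site 2} (PA : triGraph.Walk (rp m jA) yA) (PB : triGraph.Walk (rp m jB) yB)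
    (hPA : ∀ z ∈ PA.support, z = rp m jA ∨ ((m : ℤ) < triNorm z ∧ triNorm z ≤ n))
    (hPB : ∀ z ∈ PB.support, z = rp m jB ∨ ((m : ℤ) < triNorm z ∧ triNorm z ≤ n))
    (hPAp : PA.IsPath) (hPBp : PB.IsPath) (hyA : triNorm yA = n) (hyB : triNorm yB = n)
    {j j' : ℕ} (hj : jA < j) (hj2 : j < jB) (hj' : jB < j') (hj'2 : j' < jA + 6 * m)
    {S : Set (Site 2)} (hS : ∀ z ∈ S, (m : ℤ) ≤ triNorm z ∧ triNorm z ≤ n ∧ z ∉ PA.support ∧ z ∉ PB.support) :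
    ¬ PathIn triGraph S (rp m j) (rp m j') := by
  intro hp
  have hk : 1 ≤ m := by omega
  have nrp : ∀ i, triNorm (rp m i) = m := fun i => triNorm_rp hk i
  -- the arms from their second sites
  obtain ⟨pA, hopA, PA', rfl⟩ := Walk.exists_eq_cons PA (fun e => by have := congrArg triNorm e; rw [nrp, hyA] at this; omega)
  obtain ⟨pB, hopB, PB', rfl⟩ := Walk.exists_eq_cons PB (fun e => by have := congrArg triNorm e; rw [nrp, hyB] at this; omega)
  rw [SimpleGraph.Walk.cons_isPath_iff] at hPAp hPBp
  have hPA' : ∀ z ∈ PA'.support, (m : ℤ) + 1 ≤ triNorm z ∧ triNorm z ≤ n := fun z hz => by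
    rcases hPA z (by rw [SimpleGraph.Walk.support_cons]; exact List.mem_cons_of_mem _ hz) with e | h
    · exact absurd (e ▸ hz) hPAp.2
    · omega
  have hPB' : ∀ z ∈ PB'.support, (m : ℤ) + 1 ≤ triNorm z ∧ triNorm z ≤ n := fun z hz => by
    rcases hPB z (by rw [SimpleGraph.Walk.support_cons]; exact List.mem_cons_of_mem _ hz) with e | h
    · exact absurd (e ▸ hz) hPBp.2
    · omega
  -- the exterior walk
  obtain ⟨eA, eB, E, hEA, hEB, hE⟩ := exists_exterior_walk hyA hyB
  -- the arc of `∂Λ_m` between the two rim sites, and the last visit of the path to it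
  set Aset : Set (Site 2) := {z | ∃ k, jA ≤ k ∧ k ≤ jB ∧ z = rp m k} with hAset
  have hu : rp m j ∈ Aset := ⟨j, hj.le, hj2.le, rfl⟩
  have hv : rp m j' ∉ Aset := by
    rintro ⟨k, hk1, hk2, e⟩
    exact rp_ne_rp_of_lt hk (show k < j' by omega) (by omega) e.symm
  obtain ⟨a, b, haA, haS, hbA, hab, hq⟩ := hp.last_exit hu hv
  obtain ⟨k, hk1, hk2, rfl⟩ := haA
  obtain ⟨-, -, haPA, haPB⟩ := hS _ haS
  have hkA : jA < k := by
    refine lt_of_le_of_ne hk1 fun e => haPA ?_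
    rw [← e, SimpleGraph.Walk.support_cons]; exact List.mem_cons_self
  have hkB : k < jB := by
    refine lt_of_le_of_ne hk2 fun e => haPB ?_
    rw [e, SimpleGraph.Walk.support_cons]; exact List.mem_cons_self
  have hbS : b ∈ S := hq.left_mem.1
  obtain ⟨hbm, hbn, hbPA, hbPB⟩ := hS b hbS
  have hb1 := triNorm_le_triNorm_add_one_of_adj hab
  rw [nrp] at hb1
  -- `b` is not a ring site: it would be `rp m (k ± 1)`, on the arc
  have hbnorm : triNorm b = m + 1 := by
    rcases (show triNorm b = m ∨ triNorm b = m + 1 by omega) with h | h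
    · exfalso
      rcases eq_rp_of_adj_rp hk (by omega) h hab with rfl | rfl
      · exact hbA ⟨k + 1, by omega, by omega, rfl⟩
      · exact hbA ⟨k - 1, by omega, by omega, rfl⟩
    · exact h
  -- `b` lies over a bond of the arc
  obtain ⟨i, x, hi1, hi2, hx, hx₁, hx₂, hcase⟩ :=
    overBond_of_adj_ring (R := m + 1) (by omega) (b := b) (by rw [hbnorm]; push_cast; ring) (j := k) (by omega)
      (by rw [Nat.add_sub_cancel]; exact hab.symm)
  rw [Nat.add_sub_cancel] at hx₁ hx₂ hcase
  -- the separating loop, one level up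
  let C : SepLoop :=
    { R := m + 1, N := n, pA := pA, yA := yA, pB := pB, yB := yB, eA := eA, eB := eB, PA := PA', PB := PB', E := E,
      m₁ := jA, m₂ := jB, i := i,
      hR := by omega, hRN := hmn, hm₁ := by omega, hi := by omega, hm₂ := by rw [Nat.add_sub_cancel]; omega,
      PA_norm := fun z hz => by have := hPA' z hz; push_cast; exact this,
      PB_norm := fun z hz => by have := hPB' z hz; push_cast; exact this,
      E_norm := fun z hz => by rw [hE z hz],
      adjA := hEA, adjB := hEB,
      hopB := by rw [Nat.add_sub_cancel]; exact hopB.symm,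
      hopA := by rw [Nat.add_sub_cancel]; exact hopA }
  -- a site of the deep hole next to the end of the path
  have hv0 : rp m j' ≠ 0 := fun e => by have := nrp j'; rw [e, triNorm_zero] at this; omega
  obtain ⟨q, hvq, hqn⟩ := exists_triGraph_adj_triNorm_add_one_eq hv0
  rw [nrp] at hqn
  -- the winding numbers of `b` and `q` differ …
  have hne : C.W (triEmbed b) ≠ C.W (triEmbed q) := by
    refine C.W_ne (x := x) hx (by show triGraph.Adj x (rp (m + 1 - 1) i); rw [Nat.add_sub_cancel]; exact hx₁)
      (by show triGraph.Adj x (rp (m + 1 - 1) (i + 1)); rw [Nat.add_sub_cancel]; exact hx₂)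
      hbnorm (fun h => hbPA (by rw [SimpleGraph.Walk.support_cons]; exact List.mem_cons_of_mem _ h))
      (fun h => hbPB (by rw [SimpleGraph.Walk.support_cons]; exact List.mem_cons_of_mem _ h)) ?_
      (by show triNorm q ≤ (m + 1 : ℕ) - 2; push_cast; omega)
    rcases hcase with e | ⟨hbx, hbi, hik⟩
    · exact Or.inl e
    · right; right
      refine ⟨hbx, by show triGraph.Adj b (rp (m + 1 - 1) (i + 1)); rw [Nat.add_sub_cancel]; exact hbi, ?_⟩
      rintro ⟨h1, -⟩
      change i + 1 = jB at h1
      omega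
  -- … but the path joins them off the loop
  refine hne (latWind_triEmbed_eq_of_pathIn C.hadj_pieces (S := (S \ Aset) ∪ {q}) (fun z hz => C.off_pieces ?_)
    ((hq.mono Set.subset_union_left).tail hvq (Or.inr rfl)))
  rcases hz with ⟨hzS, hzA⟩ | hzq
  · obtain ⟨hz1, hz2, hzPA, hzPB⟩ := hS z hzS
    rcases (lt_or_eq_of_le hz1) with hlt | heq
    · exact C.not_mem_of_ann (by show ((m + 1 : ℕ) : ℤ) ≤ triNorm z; push_cast; omega) hz2
        (fun h => hzPA (by rw [SimpleGraph.Walk.support_cons]; exact List.mem_cons_of_mem _ h))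
        (fun h => hzPB (by rw [SimpleGraph.Walk.support_cons]; exact List.mem_cons_of_mem _ h))
    · refine C.not_mem_of_ring (by show triNorm z = ((m + 1 : ℕ) : ℤ) - 1; push_cast; omega) fun j'' hj1 hj2 e => hzA ?_
      exact ⟨j'', hj1, hj2, by rw [e]; show rp (m + 1 - 1) j'' = rp m j''; rw [Nat.add_sub_cancel]⟩
  · rw [Set.mem_singleton_iff] at hzq
    rw [hzq]
    exact C.not_mem_of_deep (by show triNorm q ≤ ((m + 1 : ℕ) : ℤ) - 2; push_cast; omega)

end Literature.Probability.Percolation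

end
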